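import Literature.MathematicalPhysics.QuantumLattice.TwoPointConnectedCoeffBound
import Literature.MathematicalPhysics.QuantumLattice.HubbardTorusSingleScalePressure
import Literature.MathematicalPhysics.QuantumLattice.HubbardTwoPointLimitReduction
import HarnessLib

/-!
# The thermodynamic limit of the 2D Hubbard two-point function at small coupling `|U| < r(β, μ)`

The two-point endpoint of the determinant-bound single-scale expansion
(`TwoPointConnectedCoeffBound.lean`) on the torus, and the single-scale corner of the programme under
the tree's fact `bgm_two_point_limit` (`HubbardFermiLiquid.lean`). `HubbardTwoPointLimitReduction.lean`
and `HubbardTruncatedCoeffThermodynamicLimit.lean` reduce that fact to hypothesis (A) alone: a geometric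
bound `‖t_j(L)‖ ≤ C/rʲ` on the truncated (linked-cluster) coefficients of the torus two-point function,
UNIFORM in the volume, with `r > |U|`. This file PROVES (A) in the corner it can hold for the bare
series — every `β ≥ 0` and `μ`, a radius `r(β, μ) > 0` independent of `L` — and draws the consequence:

* `hubbardWordPos_eq_elim`, `Torus.proj_add'`, `Torus.proj_elim` — bookkeeping: the positions of the
  pairs of the two-point word are read off the cluster map `hubbardCluster`;
* `norm_twoPointPropMatrix_torus_apply_le` — the line bound of `TwoPointConnectedCoeffBound` for the
  torus: with the uniform-in-`L` decay data `(C, K)` of the free thermal propagator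
  (`exists_norm_hubbardThermalTwoPointEvolved_le_tnZ`), every entry of the two-point propagator matrix
  is at most `γ̃(w) = C[(1+|w|)^{-K} + (1+|w-D|)^{-K} + (1+|w+D|)^{-K}]` of the difference `w` of the
  CLUSTER positions (torus norm; `D` the external separation `ȳ - x̄`), and `Σ_w γ̃(w) ≤ 3CS`,
  `S = Σ_{z ∈ ℤ²}(1+‖z‖)^{-K}` (`sum_twoPointLineWeight_le`);
* **`norm_hubbardTorusTruncatedCoeff_le`** — for all `L ≥ 3`, sites, spins and orders `j`,
  `‖t_j(L)‖ ≤ β^j/j! · (j+1)^{j-1} · 2^{2j+1} · (192 C S)^j`;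
* **`exists_norm_hubbardTorusTruncatedCoeff_le_geometric`** — hence `∃ r > 0, A ≥ 0` (depending on
  `β, μ` only) with `‖t_j(L)‖ ≤ A / rʲ` for all `L ≥ 3`: hypothesis (A) of
  `bgm_two_point_limit_of_uniform_truncated_bound` in the corner `|U| < r(β, μ)`;
* **`tendsto_hubbardThermalTwoPoint_of_small_coupling`** — THE THERMODYNAMIC LIMIT OF THE TWO-POINT
  FUNCTION OF THE 2D HUBBARD MODEL EXISTS AT SMALL COUPLING: for every `β ≥ 0` and `μ` there is
  `r > 0` such that for all real `|U| < r`, all sites and spins,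
  `⟨c†_{xσ} c_{yσ'}⟩_{β,L,U,μ} → Σ_j U^j τ_j` as `L → ∞` (with the termwise limits `τ_j` of
  `HubbardTruncatedCoeffThermodynamicLimit`), by `tendsto_hubbardThermalTwoPoint_of_truncated_bounds`.

What this is NOT. The radius is that of the BARE perturbation series at a single scale,
`r(β, μ) ∝ (β S C(β, μ))⁻¹`, polynomially small in the temperature; the fact `bgm_two_point_limit` asks for
the window `β ≤ e^{c/|U|}`, i.e. `|U| log β ≤ c`, which only the renormalised multiscale expansion of
Benfatto–Giuliani–Mastropietro 2006 (Thm. 2.1, §3: sectors, the flow of the effective couplings and of the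
chemical potential) reaches; for the bare series in `U` at fixed `μ` no volume-uniform radius beyond
`O(β⁻¹)` is to be expected (the Hartree shift `Un/2` of the chemical potential moves the Fermi-function
singularities to `|U| ≈ 2πT/n`), so hypothesis (A) as a statement about `hubbardTorusTruncatedCoeff`
is settled here in essentially its full true range `|U| ≲ T`.

Everything is PROVED; no definition and no named fact.

## References

* G. Benfatto, A. Giuliani, V. Mastropietro, Ann. Henri Poincaré 7 (2006) 809–898, §2.2–2.3,
  (2.14)–(2.16), (2.77), footnote 1 of §2.3. [cite: BenfattoGiulianiMastropietro2006, (2.77)]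
* W. de Siqueira Pedra, M. Salmhofer, Comm. Math. Phys. 282 (2008) 797–818, Thm 2.4.
  [cite: PedraSalmhofer2008, Thm 2.4]
* G. Benfatto, V. Mastropietro, Rev. Math. Phys. 13 (2001) 1323–1435, §2. [cite: BenfattoMastropietro2001, §2]
-/

noncomputable section

open scoped Matrix.Norms.L2Operator ComplexOrder
open Finset MeasureTheory Set NormedSpace Filter Topology
open Literature.Probability.LatticeModels
open Literature.Probability.LatticeModels.BattleFederbush

namespace Literature.MathematicalPhysics.QuantumLattice

/-! ### Bookkeeping: positions of the pairs through the cluster map -/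

section Bookkeeping

variable {d L : ℕ}

/-- The position of pair `a` of the two-point word is the position of its cluster: `x` for the
external pair, `Z i` for the pairs of vertex `i`. [folklore] -/
theorem hubbardWordPos_eq_elim {j : ℕ} (x : Site 2) (Z : Fin j → Site 2) (a : Fin (j * 2 + 1)) :
    hubbardWordPos x Z a = (hubbardCluster j a).elim x Z := by
  induction a using Fin.cases with
  | zero => rfl
  | succ m => simp [hubbardWordPos_succ, hubbardCluster_succ]

/-- The projection to the torus is additive. [folklore] -/
theorem Torus.proj_add' (x y : Site d) : Torus.proj L (x + y) = Torus.proj L x + Torus.proj L y := by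
  funext i
  simp [Torus.proj]

/-- Projecting the position of a cluster. [folklore] -/
theorem Torus.proj_elim {j : ℕ} (o : Option (Fin j)) (x : Site 2) (Z : Fin j → Site 2) :
    Torus.proj L (o.elim x Z) = o.elim (Torus.proj L x) (fun k => Torus.proj L (Z k)) := by
  cases o <;> rfl

end Bookkeeping

/-! ### The line bound for the two-point word on the torus -/

section LineBound

variable (β μ : ℝ) {L : ℕ} [NeZero L]

/-- **The entries of the two-point propagator matrix on the torus are small in the torus distance of
the CLUSTERS**: with the decay data `(C, K)` of the free thermal propagator for the separations
`[-2β, β]`, `C ≥ 0`, simplex times `v ∈ [0,1]^j`, external creation orbital at `x̄'`, external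
annihilation orbital at `x̄' + D̄` (`D = proj d`), vertices at `proj ∘ Z` and `L ≥ 3`, entry `(a, b)`
is at most `C[(1+|w|)^{-K} + (1+|w-D|)^{-K} + (1+|w+D|)^{-K}]`, `w` the torus difference of the
positions of the clusters of `a` and `b` (torus norm `|·| = tnorm`). [cite: BenfattoGiulianiMastropietro2006, §2.2] -/
theorem norm_twoPointPropMatrix_torus_apply_le (hβ : 0 ≤ β) {K : ℕ} {C : ℝ} (hC0 : 0 ≤ C)
    (hC : ∀ (L : ℕ), 3 ≤ L → ∀ (t s : ℝ), s - t ∈ Icc (-(2 * β)) β →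
      ∀ (x₁ y₁ : Site 2) (σ₁ σ₂ : Fin 2),
        ‖hubbardThermalTwoPointEvolved β 0 μ L x₁ σ₁ (t : ℂ) y₁ σ₂ (s : ℂ)‖ ≤
          C * ((1 + (tnZ L (y₁ - x₁) : ℝ)) ^ K)⁻¹)
    (hL : 3 ≤ L) (x' dd : Site 2) (σ σ' : Fin 2) {j : ℕ} (Z : Fin j → Site 2)
    {v : Fin j → ℝ} (hv : ∀ i, v i ∈ Icc (0 : ℝ) 1) (a b : Fin (j * 2 + 1)) :
    ‖twoPointPropMatrix β (hubbardOneBody (fermionTorusGraph 2 L) 1 μ)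
        (orb (FermionTorus.ofTorusSite (Torus.proj L x')) σ)
        (orb (FermionTorus.ofTorusSite (Torus.proj L (x' + dd))) σ')
        (fun i => FermionTorus.ofTorusSite (Torus.proj L (Z i)))
        (fun i => ((v i : ℝ) : ℂ) * -(β : ℂ)) a b‖ ≤
      C * (((1 + (Torus.tnorm
              ((hubbardCluster j a).elim (Torus.proj L x') (fun k => Torus.proj L (Z k)) -
                (hubbardCluster j b).elim (Torus.proj L x') (fun k => Torus.proj L (Z k))) : ℝ)) ^ K)⁻¹ +
        ((1 + (Torus.tnorm
              ((hubbardCluster j a).elim (Torus.proj L x') (fun k => Torus.proj L (Z k)) -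
                (hubbardCluster j b).elim (Torus.proj L x') (fun k => Torus.proj L (Z k)) -
                Torus.proj L dd) : ℝ)) ^ K)⁻¹ +
        ((1 + (Torus.tnorm
              ((hubbardCluster j a).elim (Torus.proj L x') (fun k => Torus.proj L (Z k)) -
                (hubbardCluster j b).elim (Torus.proj L x') (fun k => Torus.proj L (Z k)) +
                Torus.proj L dd) : ℝ)) ^ K)⁻¹) := by
  -- abbreviations
  set w : TorusSite 2 L :=
    (hubbardCluster j a).elim (Torus.proj L x') (fun k => Torus.proj L (Z k)) -
      (hubbardCluster j b).elim (Torus.proj L x') (fun k => Torus.proj L (Z k)) with hw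
  set D : TorusSite 2 L := Torus.proj L dd with hD
  have ht1 : 0 ≤ ((1 + (Torus.tnorm w : ℝ)) ^ K)⁻¹ := by positivity
  have ht2 : 0 ≤ ((1 + (Torus.tnorm (w - D) : ℝ)) ^ K)⁻¹ := by positivity
  have ht3 : 0 ≤ ((1 + (Torus.tnorm (w + D) : ℝ)) ^ K)⁻¹ := by positivity
  -- the entry is an evolved free two-point function (bridge) and the times are real in `[-β, 0]`
  have htime : (fun i => ((v i : ℝ) : ℂ) * -(β : ℂ)) = fun i => (((v i * -β : ℝ)) : ℂ) := by
    funext i; push_cast; ring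
  have hmem : ∀ i, v i * -β ∈ Icc (-β) 0 := fun i => by
    constructor <;> nlinarith [(hv i).1, (hv i).2]
  rw [twoPointPropMatrix_torus_eq, htime]
  refine (norm_torusWordMatrix_apply_le β μ hβ hC hL x' (x' + dd) σ σ' Z hmem a b).trans ?_
  refine mul_le_mul_of_nonneg_left ?_ hC0
  -- identify the torus distance of the pair positions with a cluster term
  rw [hubbardWordPos_eq_elim, hubbardWordPos_eq_elim]
  unfold tnZ
  rw [Torus.proj_sub, Torus.proj_elim, Torus.proj_elim]
  induction b using Fin.cases with
  | zero =>
      -- the annihilation orbital of the external pair sits at `x' + dd`: second term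
      have hb : (hubbardCluster j 0).elim (Torus.proj L (x' + dd)) (fun k => Torus.proj L (Z k)) -
          (hubbardCluster j a).elim (Torus.proj L x') (fun k => Torus.proj L (Z k)) = -(w - D) := by
        simp only [hubbardCluster_zero, Option.elim_none, hw, hD, Torus.proj_add']
        abel
      rw [hb, Torus.tnorm_neg]
      linarith
  | succ m =>
      -- a vertex pair: first term
      have hb : (hubbardCluster j m.succ).elim (Torus.proj L (x' + dd)) (fun k => Torus.proj L (Z k)) -
          (hubbardCluster j a).elim (Torus.proj L x') (fun k => Torus.proj L (Z k)) = -w := by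
        simp only [hubbardCluster_succ, Option.elim_some, hw]
        abel
      rw [hb, Torus.tnorm_neg]
      linarith

/-- **The summed line weight is at most `3 C S`, uniformly in `L`** (translation invariance of the sum
over the torus and `sum_inv_one_add_tnorm_pow_le_tsum`). [folklore] -/
theorem sum_twoPointLineWeight_le {K : ℕ} (hK : 4 ≤ K) {C : ℝ} (hC0 : 0 ≤ C) (D : TorusSite 2 L) :
    ∑ w : TorusSite 2 L, C * (((1 + (Torus.tnorm w : ℝ)) ^ K)⁻¹ +
        ((1 + (Torus.tnorm (w - D) : ℝ)) ^ K)⁻¹ + ((1 + (Torus.tnorm (w + D) : ℝ)) ^ K)⁻¹) ≤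
      3 * (C * ∑' z : Site 2, ((1 + ‖z‖) ^ K)⁻¹) := by
  have hS := sum_inv_one_add_tnorm_pow_le_tsum (L := L) hK
  have h2 : ∑ w : TorusSite 2 L, ((1 + (Torus.tnorm (w - D) : ℝ)) ^ K)⁻¹ =
      ∑ w : TorusSite 2 L, ((1 + (Torus.tnorm w : ℝ)) ^ K)⁻¹ :=
    Fintype.sum_equiv (Equiv.subRight D) _ _ fun w => rfl
  have h3 : ∑ w : TorusSite 2 L, ((1 + (Torus.tnorm (w + D) : ℝ)) ^ K)⁻¹ =
      ∑ w : TorusSite 2 L, ((1 + (Torus.tnorm w : ℝ)) ^ K)⁻¹ :=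
    Fintype.sum_equiv (Equiv.addRight D) _ _ fun w => rfl
  rw [← Finset.mul_sum, Finset.sum_add_distrib, Finset.sum_add_distrib, h2, h3]
  nlinarith

end LineBound

/-! ### The truncated coefficients of the torus two-point function -/

section Coefficients

variable (β μ : ℝ)

/-- **The single-scale bound on the truncated two-point coefficients of the 2D Hubbard torus, uniformly
in the volume**: with the decay data `C ≥ 0`, `K ≥ 4` of the free thermal propagator (separations
`[-2β, β]`) and `S = Σ_{z ∈ ℤ²} (1 + ‖z‖)^{-K}`, for all `L ≥ 3`, sites, spins and `j`,
`‖t_j(L)‖ ≤ β^j/j! · (j+1)^{j-1} · 2^{2j+1} · (8 · 3CS · 8)^j = β^j/j! · (j+1)^{j-1} · 2^{2j+1} · (192 C S)^j`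
— written below as `(8 · (3 · (C S)) )^j` times `2^{2j+1}·(j+1)^{j-1}·β^j/j!`.
[cite: BenfattoGiulianiMastropietro2006, (2.77)] -/
theorem norm_hubbardTorusTruncatedCoeff_le (hβ : 0 ≤ β) {K : ℕ} (hK : 4 ≤ K) {C : ℝ} (hC0 : 0 ≤ C)
    (hC : ∀ (L : ℕ), 3 ≤ L → ∀ (t s : ℝ), s - t ∈ Icc (-(2 * β)) β →
      ∀ (x₁ y₁ : Site 2) (σ₁ σ₂ : Fin 2),
        ‖hubbardThermalTwoPointEvolved β 0 μ L x₁ σ₁ (t : ℂ) y₁ σ₂ (s : ℂ)‖ ≤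
          C * ((1 + (tnZ L (y₁ - x₁) : ℝ)) ^ K)⁻¹)
    {L : ℕ} (hL : 3 ≤ L) (x y : Site 2) (σ σ' : Fin 2) (j : ℕ) :
    ‖hubbardTorusTruncatedCoeff β μ L x y σ σ' j‖ ≤
      β ^ j / j.factorial * (((j + 1 : ℕ) : ℝ) ^ (j - 1) *
        ((2 : ℝ) ^ (j * 2 + 1) * (8 * (3 * (C * ∑' z : Site 2, ((1 + ‖z‖) ^ K)⁻¹))) ^ j)) := by
  haveI : NeZero L := ⟨by omega⟩
  set S : ℝ := ∑' z : Site 2, ((1 + ‖z‖) ^ K)⁻¹ with hS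
  have hS0 : 0 ≤ S := tsum_nonneg fun z => by positivity
  -- sites ↔ torus points
  set pos : FermionTorus 2 L ≃ TorusSite 2 L :=
    ⟨FermionTorus.toTorusSite, FermionTorus.ofTorusSite, FermionTorus.ofTorusSite_toTorusSite,
      FermionTorus.toTorusSite_ofTorusSite⟩ with hpos
  -- the external separation on the torus and the line weight
  set D : TorusSite 2 L := Torus.proj L (y - x) with hD
  set γ : TorusSite 2 L → ℝ := fun w => C * (((1 + (Torus.tnorm w : ℝ)) ^ K)⁻¹ +
    ((1 + (Torus.tnorm (w - D) : ℝ)) ^ K)⁻¹ + ((1 + (Torus.tnorm (w + D) : ℝ)) ^ K)⁻¹) with hγ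
  have hγ0 : ∀ w, 0 ≤ γ w := fun w => by positivity
  have hγeven : ∀ w, γ (-w) = γ w := fun w => by
    simp only [hγ]
    rw [Torus.tnorm_neg, show -w - D = -(w + D) by abel, Torus.tnorm_neg,
      show -w + D = -(w - D) by abel, Torus.tnorm_neg]
    ring
  -- the external orbitals as functions of the position of the external cluster
  set ox : TorusSite 2 L → Orb (FermionTorus 2 L) := fun u => orb (FermionTorus.ofTorusSite u) σ with hox
  set oy : TorusSite 2 L → Orb (FermionTorus 2 L) :=
    fun u => orb (FermionTorus.ofTorusSite (u + D)) σ' with hoy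
  -- the coefficient in the form of `norm_twoPointConnectedCoeff_le`
  have hy : Torus.proj L y = Torus.proj L x + D := by
    rw [hD, Torus.proj_sub]; abel
  have hcoef : hubbardTorusTruncatedCoeff β μ L x y σ σ' j =
      orderedIntegral j (truncatedIntegrand β (hubbardOneBody (fermionTorusGraph 2 L) 1 μ)
        (ox (Torus.proj L x)) (oy (Torus.proj L x)) j) 1 := by
    rw [hubbardTorusTruncatedCoeff_of_neZero, hy]
    rfl
  rw [hcoef]
  have key := norm_twoPointConnectedCoeff_le β (hubbardOneBody (fermionTorusGraph 2 L) 1 μ)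
    (isHermitian_hubbardOneBody (fermionTorusGraph 2 L) 1 μ) hβ pos ox oy γ hγ0 hγeven (j := j)
    (fun v _ hv01 u g f f' => ?_) (Torus.proj L x)
  · refine key.trans ?_
    have hsumγ : ∑ w, γ w ≤ 3 * (C * S) := sum_twoPointLineWeight_le hK hC0 D
    have hsumγ0 : 0 ≤ ∑ w, γ w := sum_nonneg fun w _ => hγ0 w
    gcongr
  · -- the line bound: write the sites as projected centred representatives
    set Z : Fin j → Site 2 := fun i => Torus.cRep (FermionTorus.toTorusSite (g i)) with hZ
    have hg : g = fun i => FermionTorus.ofTorusSite (Torus.proj L (Z i)) := by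
      funext i
      simp only [hZ, Torus.proj_cRep, FermionTorus.ofTorusSite_toTorusSite]
    have hu : u = Torus.proj L (Torus.cRep u) := (Torus.proj_cRep u).symm
    have huD : u + D = Torus.proj L (Torus.cRep u + (y - x)) := by
      rw [Torus.proj_add', Torus.proj_cRep]
    have hposZ : (fun k => pos (g k)) = fun k => Torus.proj L (Z k) := by
      funext k
      simp only [hg, hpos, Equiv.coe_fn_mk, FermionTorus.toTorusSite_ofTorusSite]
    have main := norm_twoPointPropMatrix_torus_apply_le β μ hβ hC0 hC hL (Torus.cRep u) (y - x) σ σ' Z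
      hv01 f f'
    rw [Torus.proj_cRep] at main
    simp only [hox, hoy]
    rw [hposZ, huD, hg]
    exact main

/-- **Hypothesis (A) of `bgm_two_point_limit_of_uniform_truncated_bound` in the single-scale corner**:
for every `β ≥ 0` and `μ` there are `r > 0` and `A ≥ 0` such that for all `L ≥ 3`, all sites, spins and
orders, `‖t_j(L)‖ ≤ A / rʲ` — a geometric bound on the truncated coefficients of the torus two-point
function, uniform in the volume (`(j+1)^{j-1}/j! ≤ e^{j+1}`). The radius is `∝ (β C S)⁻¹`.
[cite: BenfattoGiulianiMastropietro2006, (2.77)] -/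
theorem exists_norm_hubbardTorusTruncatedCoeff_le_geometric (hβ : 0 ≤ β) :
    ∃ r : ℝ, 0 < r ∧ ∃ A : ℝ, 0 ≤ A ∧ ∀ (L : ℕ), 3 ≤ L → ∀ (x y : Site 2) (σ σ' : Fin 2) (j : ℕ),
      ‖hubbardTorusTruncatedCoeff β μ L x y σ σ' j‖ ≤ A / r ^ j := by
  -- decay data for the separations `[-2β, β]`, `K = 4`
  obtain ⟨C, hCpos, hC⟩ := exists_norm_hubbardThermalTwoPointEvolved_le_tnZ β μ (-(2 * β)) β
    (K := 4) le_rfl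
  set S : ℝ := ∑' z : Site 2, ((1 + ‖z‖) ^ 4)⁻¹ with hS
  have hS0 : 0 ≤ S := tsum_nonneg fun z => by positivity
  -- the constants: `t_j ≤ 2e · (4 e β · 24 C S)^j`
  set ϱ : ℝ := 96 * Real.exp 1 * β * (C * S) + 1 with hϱ
  have hϱ1 : 1 ≤ ϱ := by
    have : 0 ≤ 96 * Real.exp 1 * β * (C * S) := by positivity
    linarith
  have hϱpos : 0 < ϱ := by linarith
  refine ⟨ϱ⁻¹, by positivity, 2 * Real.exp 1, by positivity, fun L hL x y σ σ' j => ?_⟩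
  refine (norm_hubbardTorusTruncatedCoeff_le β μ hβ le_rfl hCpos.le hC hL x y σ σ' j).trans ?_
  rw [inv_pow, div_inv_eq_mul]
  -- `(j+1)^{j-1}/j! ≤ e^{j+1}`
  have hfact : ((j + 1 : ℕ) : ℝ) ^ (j - 1) / j.factorial ≤ Real.exp 1 ^ (j + 1) := by
    have hj1 : (1 : ℝ) ≤ ((j + 1 : ℕ) : ℝ) := by exact_mod_cast Nat.succ_le_succ (Nat.zero_le j)
    have hne : ((j + 1 : ℕ) : ℝ) ≠ 0 := by positivity
    have hfj : (j.factorial : ℝ) ≠ 0 := by exact_mod_cast (Nat.factorial_pos j).ne'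
    calc ((j + 1 : ℕ) : ℝ) ^ (j - 1) / j.factorial ≤ ((j + 1 : ℕ) : ℝ) ^ j / j.factorial :=
          div_le_div_of_nonneg_right (pow_le_pow_right₀ hj1 (Nat.sub_le j 1)) (by positivity)
      _ = ((j + 1 : ℕ) : ℝ) ^ (j + 1) / (j + 1).factorial := by
          rw [Nat.factorial_succ, pow_succ]
          push_cast
          field_simp
      _ ≤ Real.exp ((j + 1 : ℕ) : ℝ) :=
          Real.pow_div_factorial_le_exp (x := ((j + 1 : ℕ) : ℝ)) (by positivity) (j + 1)
      _ = Real.exp 1 ^ (j + 1) := by rw [← Real.exp_nat_mul, mul_one]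
  have h4 : (2 : ℝ) ^ (j * 2 + 1) = 2 * 4 ^ j := by
    rw [pow_succ, mul_comm j 2, pow_mul]; norm_num; ring
  have hCS : 0 ≤ C * S := by positivity
  calc β ^ j / j.factorial * (((j + 1 : ℕ) : ℝ) ^ (j - 1) *
        ((2 : ℝ) ^ (j * 2 + 1) * (8 * (3 * (C * S))) ^ j))
      = (((j + 1 : ℕ) : ℝ) ^ (j - 1) / j.factorial) * (β ^ j * (2 * 4 ^ j * (24 * (C * S)) ^ j)) := by
        rw [h4]; ring
    _ ≤ Real.exp 1 ^ (j + 1) * (β ^ j * (2 * 4 ^ j * (24 * (C * S)) ^ j)) := by gcongr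
    _ = 2 * Real.exp 1 * (96 * Real.exp 1 * β * (C * S)) ^ j := by
        have h96 : (96 : ℝ) ^ j = 4 ^ j * 24 ^ j := by rw [← mul_pow]; norm_num
        simp only [mul_pow, pow_succ]
        rw [h96]
        ring
    _ ≤ 2 * Real.exp 1 * ϱ ^ j := by
        gcongr
        rw [hϱ]
        linarith

/-- **The thermodynamic limit of the two-point function of the 2D Hubbard model exists at small
coupling.** For every `β ≥ 0` and `μ` there is `r > 0` such that for every real coupling `|U| < r`,
all sites `x, y ∈ ℤ²` and spins, the finite-volume thermal two-point functions
`⟨c†_{xσ} c_{yσ'}⟩_{β,L}` of `hubbardTorusWith 2 L 1 U μ` converge as `L → ∞`, to the sum `Σ_j U^j τ_j`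
of the termwise limits of the linked-cluster coefficients — finite-temperature perturbation theory of
the two-point Schwinger function converges uniformly in the volume and passes to the limit
(Benfatto–Giuliani–Mastropietro 2006, §2.2–2.3 at a single scale: the corner `|U| < r(β, μ) ∝ T` of the
tree's fact `bgm_two_point_limit`, whose window `β ≤ e^{c/|U|}` needs the multiscale analysis).
[cite: BenfattoGiulianiMastropietro2006, §2.3 footnote 1] -/
theorem tendsto_hubbardThermalTwoPoint_of_small_coupling (hβ : 0 ≤ β) :
    ∃ r : ℝ, 0 < r ∧ ∀ U : ℝ, |U| < r → ∀ (x y : Site 2) (σ σ' : Fin 2),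
      Tendsto (fun L : ℕ => hubbardThermalTwoPoint β U μ L x y σ σ') atTop
        (𝓝 (∑' j : ℕ, (U : ℂ) ^ j * hubbardInfTruncatedCoeff β μ x y σ σ' j)) := by
  obtain ⟨r, hr, A, -, hA⟩ := exists_norm_hubbardTorusTruncatedCoeff_le_geometric β μ hβ
  refine ⟨r, hr, fun U hU x y σ σ' => ?_⟩
  refine tendsto_hubbardThermalTwoPoint_of_truncated_bounds β U μ x y σ σ' hU (C := A) ?_
    (termwise_limit_hubbardTorusTruncatedCoeff β μ hβ x y σ σ')
  filter_upwards [eventually_ge_atTop 3] with L hL j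
  exact hA L hL x y σ σ' j

/-- **Corollary (the fact's shape).** In particular the infinite-volume two-point function exists at
small coupling: `∃ S, ⟨c†_{xσ} c_{yσ'}⟩_{β,L,U,μ} → S`, for every `β > 0`, `μ`, `|U| < r(β, μ)` — the
conclusion of `bgm_two_point_limit` on the single-scale corner of its window.
[cite: BenfattoGiulianiMastropietro2006, Thm. 1.1] -/
theorem hubbardTwoPoint_limit_exists_of_small_coupling {β : ℝ} (hβ : 0 < β) (μ : ℝ) :
    ∃ r : ℝ, 0 < r ∧ ∀ U : ℝ, |U| < r → ∀ (x y : Site 2) (σ σ' : Fin 2), ∃ S : ℂ,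
      Tendsto (fun L : ℕ => hubbardThermalTwoPoint β U μ L x y σ σ') atTop (𝓝 S) := by
  obtain ⟨r, hr, h⟩ := tendsto_hubbardThermalTwoPoint_of_small_coupling β μ hβ.le
  exact ⟨r, hr, fun U hU x y σ σ' => ⟨_, h U hU x y σ σ'⟩⟩

end Coefficients

end Literature.MathematicalPhysics.QuantumLattice
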